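/-
Copyright (c) 2026 the pub-hodgecm-mathlib formalisation cell (harness21).  Prover seat hodgecm-mathlib-F0P3a-p01 (g33), req620 Track A «(D-RAM) FOUR-FRAME» squad, unit U2H:
the (ρ2b′-X) child (U2H ED. 15 :418) — organ O-Lit brick 2 (wild anisotropic literal), file (γ) «THE INTEGRAL DRESS AT A WILD PLACE» (PLAN v1 04:56Z; MAP v1 seams S3∕S5;
payer lineage LH4-p14).  2026-09-04.
-/
import Literature.NumberTheory.Automorphic.LocalHermitianFormsRankThreeCongruence        -- ★ Jacobowitz rank 3, local coefficients: `exists_formCongr_eq_of_det_eq_mul_norm_three`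
import Literature.NumberTheory.GelbartRogawski1991.LocalDoubledUnitaryIwahori             -- ★ `LocalRing.evalEquiv` (`L ⊗ L⁺_v ≃+* L_w` at a non-split place)
import Literature.NumberTheory.Rogawski1990.ExplicitFactorKappaAlmostEverywhereOne        -- ★ `conjLocal_apply_eq_galAdicCompletionMap` (`(c ⊗ 1)_w = σ_w`)
import Literature.NumberTheory.Rogawski1990.UnitaryLatticeTreeSelfDualTransitiveWildCM    -- ★ WILD TRANSITIVITY `exists_unitary_mapGL_eq_of_isSelfDualLattice_ramifiedCM`
import Literature.NumberTheory.Automorphic.UnitaryLatticeTreeStabilizer                  -- ★ `mapGL_stdLattice_eq_iff` (`Stab(𝒪³) = GL₃(𝒪)`)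
import Literature.NumberTheory.Automorphic.UnitaryLatticeTreeStarOfInvolution            -- ★ `isSelfDualLattice_stdLattice_three_of_v`
import Literature.NumberTheory.Automorphic.UnitaryLatticeTreeTypes                       -- ★ `isIntMatrix_nonsing_inv_of_v_det_eq_one`
import Literature.NumberTheory.Automorphic.UnitaryConjClassClosed                        -- ★ `formCongr_mul`, `formCongr_mul_of_mem`
import Literature.NumberTheory.Automorphic.UnitaryGroupLevelTransport                    -- ★ `formCongr_map`
import Literature.NumberTheory.Automorphic.ValuedFieldValuativeRelBridge                 -- ★ `mem_glInt_iff_forall_v_le_one`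
import Literature.NumberTheory.QuadraticForms.HermitianUnimodularRankThreeRamified       -- ★ `antidiagonal_three_over`
import Literature.NumberTheory.Automorphic.QuadraticHeckeCharacterCM                     -- ★ `cmQuadraticGenerator_spec` (a `c`-anti-fixed `δ ≠ 0`)
import HarnessLib

/-!
# Crux `H413`, line LH4 «(D-RAM) FOUR-FRAME» road — unit U2H, (ρ2b′-X), organ O-Lit brick 2, file (γ): AN INTEGRAL ISOMETRY `ᵗσ̄P·J₀·P = H`, `P ∈ GL₃(𝒪_w)`, AT A WILD PLACE

Cell `hodgecm-mathlib` (D-0151), FLOOR 0, crux item H413 = `stmt-HodgeConjecture-24833`, route of record `HCCMUnconditional`; squad F0∕P3c∕LH4; registered stub served: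
`F0P3cDyRamFourFrameU2H.stub_U2H_fixedPointCensus_typeTwo_unit0` ((ρ2b′-X), U2H ED. 15 :418) through the organs of RHO2BX-ORDER v1 (payer LH4-p14; MAP v1 seams S3 «O-Lit» and S5
«N(ta)»).  THEOREMS ONLY (no `def`, no instance, no notation, no `sorry`); lane `--supports stmt-HodgeConjecture-24833 --as helper` (count-neutral).

WHAT THIS FILE DOES.  The 2-FREE twin of ★ p846940 `exists_glInt_formCongr_antidiagonal_eq_of_map_mul_self_eq_neg_det_adicCompletion` (which needs `|2|_w = 1`, residual isotropy and a
trace element): at ANY ramified non-split CM place `w ∣ v` (`e(w|v) ≠ 1`, any residue characteristic), a `σ_w`-hermitian INTEGRAL UNIMODULAR `H ∈ M₃(L_w)` (`|det H|_w = 1`) whose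
determinant lies in the norm class of `det J₀` (`det H = det J₀·σ_w(z)·z`) is INTEGRALLY isometric to `J₀ = antidiag(1,1,1)`:
**`exists_glInt_formCongr_antidiagonal_eq_wild`** — `∃ P ∈ GL₃(𝒪_w)`, `ᵗσ_w(P)·J₀·P = H`.
Proof: (i) rationally, `ᵗσ̄T J₀ T = H` for some `T ∈ GL₃(L_w)` by Jacobowitz's classification (rank + determinant class; ★ `exists_formCongr_eq_of_det_eq_mul_norm_three` over the
local ring `L ⊗ L⁺_v`, moved to `L_w` along ★ `LocalRing.evalEquiv`); (ii) the lattice `T·𝒪³` is then SELF-DUAL for `J₀` (its Gram matrix in the basis `T` is `H`: integral,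
unimodular) — by the DEFINITION of ★ `IsSelfDualLattice`; (iii) ★ WILD TRANSITIVITY `exists_unitary_mapGL_eq_of_isSelfDualLattice_ramifiedCM` (`U(σ_w, J₀)` is transitive on self-dual
vertices at every ramified place) gives `u ∈ U(J₀)` with `u·𝒪³ = T·𝒪³`; (iv) `P := u⁻¹T` stabilises `𝒪³`, so `P ∈ GL₃(𝒪_w)` (★ `mapGL_stdLattice_eq_iff`), and `ᵗσ̄P J₀ P = ᵗσ̄T J₀ T = H`.
Helpers: `antidiagonal_three_map` (`J₀` is preserved by ring maps), `det_antidiagonal_three`, `isIntMatrix_smul_of_v_le_one`.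
HONEST LABEL.  Count-neutral helper; (ρ2b′-X) stays an OPEN prover target; `HC_CM` is proved only modulo the 7 printed citations (2 remaining named inputs: hLiu418 =
`stmt-HodgeConjecture-24832`, h413 = `stmt-HodgeConjecture-24833`) until rung 0 closes.

## References
* [Jacobowitz1962] R. Jacobowitz, *Hermitian forms over local fields*, Amer. J. Math. 84 (1962), §3 Thm. 3.1 (rank and determinant classify hermitian spaces), §7–§8, §10 Prop. 10.3
  (unimodular lattices at ramified dyadic primes).
* [BruhatTits1972] F. Bruhat, J. Tits, *Groupes réductifs sur un corps local I*, Publ. Math. IHÉS 41 (1972), §10 (transitivity on hyperspecial vertices).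
* [Rogawski1990] J. D. Rogawski, *Automorphic Representations of Unitary Groups in Three Variables*, Ann. of Math. Stud. 123 (1990), §3.6 p. 31, §4.9 p. 54.
-/

set_option autoImplicit false

noncomputable section

open NumberField IsDedekindDomain Matrix
open Literature.NumberTheory.Automorphic Literature.NumberTheory.Automorphic.UnitaryGroup Literature.NumberTheory.Automorphic.UnitaryLatticeTree
open Literature.NumberTheory.Rogawski1990 Literature.NumberTheory.Automorphic.HermitianLattice
open scoped MatrixGroups ValuativeRel

namespace Summit.HodgeConjecture.HodgeConjecture.Cruxes.H413.F0P3cDyRamWildIntegralDress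

/-! ## §1 Helpers -/

/-- `J₀ = antidiag(1,1,1)` is preserved entrywise by ring maps. [cite: Rogawski1990, §3.6 p. 31] -/
theorem antidiagonal_three_map {R S : Type*} [CommRing R] [CommRing S] (f : R →+* S) :
    ((StdForm.antidiagonal 3).over R).map f = (StdForm.antidiagonal 3).over S := by
  rw [Literature.NumberTheory.QuadraticForms.HermitianUnimodularRamified.antidiagonal_three_over,
    Literature.NumberTheory.QuadraticForms.HermitianUnimodularRamified.antidiagonal_three_over]
  ext i j; fin_cases i <;> fin_cases j <;> simp

/-- `det J₀ = −1`. [cite: Rogawski1990, §3.6 p. 31] -/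
theorem det_antidiagonal_three {R : Type*} [CommRing R] : ((StdForm.antidiagonal 3).over R).det = -1 := by
  rw [Literature.NumberTheory.QuadraticForms.HermitianUnimodularRamified.antidiagonal_three_over, Matrix.det_fin_three]
  simp

/-- A scalar multiple `ϖ • A` of an integral matrix by an integral scalar is integral. [cite: Jacobowitz1962, §7] -/
theorem isIntMatrix_smul_of_v_le_one {K : Type*} [Field K] [Valued K (WithZero (Multiplicative ℤ))] {N : ℕ} {ϖ : K} (hϖ : Valued.v ϖ ≤ 1) {A : Matrix (Fin N) (Fin N) K}
    (hA : IsIntMatrix A) : IsIntMatrix (ϖ • A) := fun i j => by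
  rw [Matrix.smul_apply, smul_eq_mul, map_mul]
  exact mul_le_one' hϖ (hA i j)

/-! ## §2 The integral dress at a wild place -/

section CM

variable (L : Type) [Field L] [NumberField L] [IsCMField L] {v : HeightOneSpectrum (𝓞 ↥(maximalRealSubfield L))}
  (w : PlacesOver L v) (hw : IsCMField.complexConj L • w.1 = w.1)

include hw in
/-- **O-Lit brick 2 (γ): AN INTEGRAL ISOMETRY ONTO A UNIMODULAR HERMITIAN `H` OF THE DETERMINANT CLASS OF `J₀`, AT A WILD RAMIFIED NON-SPLIT CM PLACE** (`e(w|v) ≠ 1`, any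
residue characteristic): `H` `σ_w`-hermitian, integral, `|det H|_w = 1`, `det H = det J₀·(σ_w z·z)` for some `z` ⟹ `ᵗσ_w(P)·J₀·P = H` for some `P ∈ GL₃(𝒪_w)`.  (Jacobowitz rank 3 over
`L_w` + wild transitivity of `U(σ_w, J₀)` on self-dual vertices; see the module docstring.) [cite: Jacobowitz1962, §3 Thm. 3.1; §10 Prop. 10.3] [cite: BruhatTits1972, §10]
[cite: Rogawski1990, §3.6 p. 31] -/
theorem exists_glInt_formCongr_antidiagonal_eq_wild (he : v.asIdeal.ramificationIdx' w.1.asIdeal ≠ 1)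
    {ϖ : w.1.adicCompletion L} (hϖ : Valued.v ϖ = WithZero.exp (-1 : ℤ))
    {H : Matrix (Fin 3) (Fin 3) (w.1.adicCompletion L)} (hH : (H.map (galAdicCompletionMap (L := L) (IsCMField.complexConj L) hw))ᵀ = H) (hHint : IsIntMatrix H)
    (hdet : Valued.v H.det = 1)
    (hdetN : ∃ z : w.1.adicCompletion L, z ≠ 0 ∧ H.det = ((StdForm.antidiagonal 3).over (w.1.adicCompletion L)).det * (galAdicCompletionMap (L := L) (IsCMField.complexConj L) hw z * z)) :
    ∃ P : GL (Fin 3) (w.1.adicCompletion L), P ∈ glInt 3 (w.1.adicCompletion L) ∧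
      formCongr (galAdicCompletionMap (L := L) (IsCMField.complexConj L) hw) P ((StdForm.antidiagonal 3).over (w.1.adicCompletion L)) = H := by
  classical
  set σ := galAdicCompletionMap (L := L) (IsCMField.complexConj L) hw with hσdef
  have hc1 : IsCMField.complexConj L ≠ 1 := IsCMField.complexConj_ne_one L
  haveI : Algebra.IsQuadraticExtension ↥(maximalRealSubfield L) L := IsCMField.isQuadraticExtension L
  -- (i) rational congruence over the local ring `L ⊗ L⁺_v`, read at `w`
  obtain ⟨δ, hδ0, hcδ, -⟩ := cmQuadraticGenerator_spec L
  set e := Literature.NumberTheory.GelbartRogawski1991.UnitaryDualPair.LocalSplitting.LocalRing.evalEquiv ↥(maximalRealSubfield L) L (IsCMField.complexConj L) v hc1 w hw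
    with he_def
  have he_apply : ∀ x : UnitaryGroup.LocalRing L v, e x = x w := fun x => rfl
  have hconj : ∀ x : UnitaryGroup.LocalRing L v, e (UnitaryGroup.conjLocal L (IsCMField.complexConj L) v x) = σ (e x) := fun x => by
    rw [he_apply, he_apply, hσdef]; exact conjLocal_apply_eq_galAdicCompletionMap L v w hw x
  have hconj' : ∀ y : w.1.adicCompletion L, UnitaryGroup.conjLocal L (IsCMField.complexConj L) v (e.symm y) = e.symm (σ y) := fun y => by
    apply e.injective; rw [hconj, e.apply_symm_apply, e.apply_symm_apply]
  set G : Matrix (Fin 3) (Fin 3) (UnitaryGroup.LocalRing L v) := (StdForm.antidiagonal 3).over (UnitaryGroup.LocalRing L v) with hGdef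
  set G' : Matrix (Fin 3) (Fin 3) (UnitaryGroup.LocalRing L v) := H.map e.symm.toRingHom with hG'def
  have hee : (⇑e.toRingHom ∘ ⇑e.symm.toRingHom : w.1.adicCompletion L → w.1.adicCompletion L) = id := funext fun x => e.apply_symm_apply x
  have hGmap : G.map e.toRingHom = (StdForm.antidiagonal 3).over (w.1.adicCompletion L) := antidiagonal_three_map e.toRingHom
  have hG'map : G'.map e.toRingHom = H := by rw [hG'def, Matrix.map_map, hee, Matrix.map_id]
  have hG : (G.map (UnitaryGroup.conjLocal L (IsCMField.complexConj L) v))ᵀ = G := by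
    -- (`J₀` is hermitian for any `σ`; ★ `K2E3SupercuspModelFrameAtPlace.over_three_hermitian` states it in another road — re-derived inline to keep imports local)
    rw [hGdef, antidiagonal_three_map, Literature.NumberTheory.QuadraticForms.HermitianUnimodularRamified.antidiagonal_three_over]
    refine Matrix.ext fun i j => ?_
    fin_cases i <;> fin_cases j <;> rfl
  have hG' : (G'.map (UnitaryGroup.conjLocal L (IsCMField.complexConj L) v))ᵀ = G' := by
    refine Matrix.ext fun i j => ?_
    have h := congr_fun (congr_fun hH i) j
    rw [Matrix.transpose_apply, Matrix.map_apply] at h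
    rw [Matrix.transpose_apply, Matrix.map_apply, hG'def, Matrix.map_apply, Matrix.map_apply]
    change UnitaryGroup.conjLocal L (IsCMField.complexConj L) v (e.symm (H j i)) = e.symm (H i j)
    rw [hconj', h]
  have hGd : IsUnit G.det := by rw [hGdef, det_antidiagonal_three]; exact isUnit_one.neg
  have hHd0 : H.det ≠ 0 := fun h0 => by rw [h0, map_zero] at hdet; exact zero_ne_one hdet
  have hG'd : IsUnit G'.det := by
    rw [hG'def, ← RingHom.mapMatrix_apply, ← RingHom.map_det]; exact (isUnit_iff_ne_zero.2 hHd0).map _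
  obtain ⟨z, hz0, hz⟩ := hdetN
  have hdet' : ∃ z' : UnitaryGroup.LocalRing L v, IsUnit z' ∧ G'.det = G.det * (UnitaryGroup.conjLocal L (IsCMField.complexConj L) v z' * z') := by
    refine ⟨e.symm z, (isUnit_iff_ne_zero.2 hz0).map _, ?_⟩
    have hGdet : G.det = e.symm ((StdForm.antidiagonal 3).over (w.1.adicCompletion L)).det := by
      apply e.injective
      rw [e.apply_symm_apply, ← hGmap, ← RingHom.mapMatrix_apply, ← RingHom.map_det]; rfl
    rw [hG'def, ← RingHom.mapMatrix_apply, ← RingHom.map_det, RingEquiv.toRingHom_eq_coe, RingEquiv.coe_toRingHom, hz, map_mul, map_mul, hGdet,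
      hconj']
  obtain ⟨T, hT⟩ := exists_formCongr_eq_of_det_eq_mul_norm_three L v (IsCMField.complexConj L) hcδ hδ0 w hw hG hG' hGd hG'd hdet'
  -- (ii) move `T` to `L_w`: `ᵗσ̄T′ J₀ T′ = H`
  set T' : GL (Fin 3) (w.1.adicCompletion L) := Matrix.GeneralLinearGroup.map e.toRingHom T with hT'def
  have hT' : formCongr σ T' ((StdForm.antidiagonal 3).over (w.1.adicCompletion L)) = H := by
    have h := congrArg (fun X : Matrix (Fin 3) (Fin 3) (UnitaryGroup.LocalRing L v) => X.map e.toRingHom) hT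
    rw [formCongr_map (UnitaryGroup.conjLocal L (IsCMField.complexConj L) v) e.toRingHom (fun x => hconj x), hGmap, hG'map] at h
    exact h
  -- (iii) `T′·𝒪³` is self-dual for `J₀`
  have hϖ1 : Valued.v ϖ ≤ 1 := by
    rw [hϖ, ← WithZero.exp_zero]; exact WithZero.exp_le_exp.2 (by norm_num)
  have hHinv : IsIntMatrix (ϖ • H⁻¹) := isIntMatrix_smul_of_v_le_one hϖ1 (isIntMatrix_nonsing_inv_of_v_det_eq_one hHint hdet)
  have hSD : IsSelfDualLattice σ ϖ ((StdForm.antidiagonal 3).over (w.1.adicCompletion L)) (latt (T' : Matrix (Fin 3) (Fin 3) (w.1.adicCompletion L))) := by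
    refine ⟨T', rfl, ?_, ?_, ?_⟩
    · rw [hT']; exact hHint
    · rw [hT']; exact hHinv
    · rw [hT', hdet, pow_zero]
  have h₀ : IsSelfDualLattice σ ϖ ((StdForm.antidiagonal 3).over (w.1.adicCompletion L)) (stdLattice (w.1.adicCompletion L) 3) :=
    isSelfDualLattice_stdLattice_three_of_v hϖ
  -- (iv) wild transitivity and the stabiliser of `𝒪³`
  obtain ⟨u, hu⟩ := exists_unitary_mapGL_eq_of_isSelfDualLattice_ramifiedCM L v w hw he hϖ h₀ hSD
  have hT'std : mapGL T' (stdLattice (w.1.adicCompletion L) 3) = latt (T' : Matrix (Fin 3) (Fin 3) (w.1.adicCompletion L)) := rfl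
  set P : GL (Fin 3) (w.1.adicCompletion L) := (u : GL (Fin 3) (w.1.adicCompletion L))⁻¹ * T' with hPdef
  have hPstd : mapGL P (stdLattice (w.1.adicCompletion L) 3) = stdLattice (w.1.adicCompletion L) 3 := by
    rw [hPdef, mapGL_mul, hT'std, ← hu, ← mapGL_mul, inv_mul_cancel, mapGL_one]
  have hPint := (mapGL_stdLattice_eq_iff P).1 hPstd
  refine ⟨P, (mem_glInt_iff_forall_v_le_one P).2 ⟨hPint.1, hPint.2⟩, ?_⟩
  have huinv : ((u : GL (Fin 3) (w.1.adicCompletion L))⁻¹) ∈ unitaryGroupOfForm σ ((StdForm.antidiagonal 3).over (w.1.adicCompletion L)) :=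
    (unitaryGroupOfForm σ ((StdForm.antidiagonal 3).over (w.1.adicCompletion L))).inv_mem u.2
  rw [hPdef, formCongr_mul_of_mem σ _ huinv, hT']

end CM

end Summit.HodgeConjecture.HodgeConjecture.Cruxes.H413.F0P3cDyRamWildIntegralDress

end
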